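/-
Origin: expansion seat `planner-pub-hodgecm-mc-glue-1-0`, handover #30 2026-08-18T19:11Z md5 a9545fb428ab1c4454c382a6fd8fc53c (NEW additive leaf, 182 l., junction J2d = FIX-1 level-change laws T1/T3/index in Q.H; PKG CLAIM window -> 19:22Z; INSTALL ONLY WITH/AFTER rows #2-#26, #27, #29 (imports HodgeCM.Model.Junction.PieceEmbedding + HodgeCM.Vendored.H21.NumberTheory.Automorphic.LevelOrbitSubpiecesMeasure); nothing landed imports it; clean-room as-landed rehearsa (`HOME/mc/pub-hodgecm-mc-glue-1/aslanded/HodgeCM/Model/Junction/LevelChange.lean`, md5 a9545fb4, 182 lines);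
landed by the packager successor (mc-unitary-1-g3, gen-8 kit) in gate run 32 as `HodgeCM/Model/Junction/LevelChange.lean` (verbatim).
-/
/-
Origin: speedrun cell pub-hodgecm, MODEL-CONSTRUCTION sub-cell, unit pub-hodgecm-mc-glue-1 (node E-J, junction J2d =
FIX-1 level-change laws for `emb` read in the package carrier `Q.H`; E2-INSTANCE-SPEC-prl1 §3 / mc-autform-2
HANDOFF §3 binders `Fact_embRestrict` (T1) and `Fact_embSpread` (T3)), seat planner-pub-hodgecm-mc-glue-1-0,
2026-08-18.
Target in PKG: HodgeCM/Model/Junction/LevelChange.lean (NEW additive leaf; nothing landed imports it).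
P0 NOTE: imports the vendored harness-tree module `LevelOrbitSubpiecesMeasure` (mc-autform-2 D1-aut-iv-L²,
p178051) under its vendored name and this unit's junction J2c `PieceEmbedding`.
-/
import Summits.HodgeConjecture.HodgeCM.Model.Junction.PieceEmbedding
import Literature.NumberTheory.Automorphic.LevelOrbitSubpiecesMeasure

/-!
# Junction J2d: level change for the piece embedding, read in `Q.H`

The tree proves, in `Lp(G₁ ⧸ Γ₁, μ)`, the three level-change laws of the piece lift for open subgroups
`M' ≤ M ≤ G₁` (Getz–Hahn (6.8)): **T1** pull-back along the level covering = restriction to the sub-piece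
(`coeFn_pieceLiftLp_levelCover`), **T3** the level-`M` lift is the sum of translates of the level-`M'` lift of the
pull-back over sub-piece representatives `k_i ∈ ker π ∩ N(M')` (`pieceLiftLp_eq_sum_translate`), and the
**index law** for inner products (`inner_pieceLiftLp_eq_card_mul`), plus orthogonality of distinct translates.

This file transports them through junction J2/J2c into the package carrier `Q.H = L²(Q.G ⧸ Q.Γ, Q.ν)` with the
package's regular representation `Q.R` (`= QuotientSmoothing.ρ Q.ν`):

* `translateLp_eq_ρ` : the tree's `LevelOrbit.translateLp ℂ μ 2 g` IS the package's `ρ μ g` (`rfl`);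
* `transportL2_translateLp` : `transportL2 (translateLp g F) = Q.R (e g) (transportL2 F)`;
* `coeFn_pieceEmb_levelCover` / `coeFn_pieceEmb_levelCover_indicator` (T1 in `Q.H`, the shape of
  `Fact_embRestrict`): `pieceEmb_{M'} (f ∘ levelCover) = 𝟙_{sub-piece} · pieceEmb_M f` a.e. `[Q.ν]`;
* `pieceEmb_eq_sum_R` (T3 in `Q.H`, the shape of `Fact_embSpread`):
  `pieceEmb_M f = ∑ i, Q.R (e k_i) (pieceEmb_{M'} (f ∘ levelCover))`;
* `inner_R_pieceEmb_eq_zero` (distinct translates are orthogonal in `Q.H`), `inner_pieceEmb_eq_card_mul` and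
  `norm_sq_pieceEmb_eq_card_mul` (index law in `Q.H`).

Everything is proved; 0 hypotheses beyond the data; 0 MODEL-N.
-/

set_option autoImplicit false

noncomputable section

open MeasureTheory Literature.MeasureTheory.Group Literature.NumberTheory.Automorphic
open scoped ENNReal InnerProductSpace

namespace HodgeCM

namespace QuotientModel

open HodgeCM.PerL34 HodgeCM.PerL34.QuotientSmoothing

section Translate

variable {G₁ : Type*} [Group G₁] [TopologicalSpace G₁] [IsTopologicalGroup G₁] {Γ₁ : Subgroup G₁}
  [MeasurableSpace (G₁ ⧸ Γ₁)] [BorelSpace (G₁ ⧸ Γ₁)] (μ : Measure (G₁ ⧸ Γ₁))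
  [SMulInvariantMeasure G₁ (G₁ ⧸ Γ₁) μ]

/-- **Junction**: the tree's `L²`-translation `translateLp ℂ μ 2 g` (`F ↦ F ∘ (g⁻¹ • ·)`) is the package's regular
representation operator `ρ μ g`, definitionally. -/
theorem translateLp_eq_ρ (g : G₁) (F : Lp ℂ 2 μ) : LevelOrbit.translateLp ℂ μ 2 g F = ρ μ g F :=
  rfl

end Translate

variable (Q : QuotientModel) {G₁ : Type*} [Group G₁] [TopologicalSpace G₁] [IsTopologicalGroup G₁]
  (Γ₁ : Subgroup G₁) (e : G₁ ≃ₜ* Q.G) (hΓ : ∀ g, e g ∈ Q.Γ ↔ g ∈ Γ₁)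
  [MeasurableSpace (G₁ ⧸ Γ₁)] [BorelSpace (G₁ ⧸ Γ₁)]

/-- `transportL2 (translateLp g F) = Q.R (e g) (transportL2 F)` (junction J2 `transportL2_ρ` in tree notation). -/
theorem transportL2_translateLp (g : G₁) (F : Lp ℂ 2 (Q.pullbackν Γ₁ e hΓ)) :
    Q.transportL2 Γ₁ e hΓ (LevelOrbit.translateLp ℂ (Q.pullbackν Γ₁ e hΓ) 2 g F) =
      Q.R (e g) (Q.transportL2 Γ₁ e hΓ F) :=
  Q.transportL2_ρ Γ₁ e hΓ g F

variable (M : Subgroup G₁) {A : Type*} [Group A] [TopologicalSpace A] [IsTopologicalGroup A] (π : M →* A)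
  (x : G₁ ⧸ Γ₁) (M' : Subgroup G₁) (hle : M' ≤ M)
  [CompactSpace (A ⧸ LevelOrbit.pieceLattice M Γ₁ π x)]
  [CompactSpace (A ⧸ LevelOrbit.pieceLattice M' Γ₁ (π.comp (Subgroup.inclusion hle)) x)]

omit [CompactSpace (A ⧸ LevelOrbit.pieceLattice M Γ₁ π x)] in
/-- **T1 in `Q.H`** (pull-back = restriction, a.e.): the piece embedding at level `M'` of the pull-back
`f ∘ levelCover` is represented on `Q.G ⧸ Q.Γ` by the indicator of the sub-piece `M' • x` times the zero-extension
of `f`, read through `e⁻¹`. -/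
theorem coeFn_pieceEmb_levelCover (hπ : Continuous π) (hM' : IsOpen (M' : Set G₁))
    (f : C(A ⧸ LevelOrbit.pieceLattice M Γ₁ π x, ℂ)) :
    (Q.pieceEmb Γ₁ e hΓ M' (π.comp (Subgroup.inclusion hle)) x hM' (hπ.comp (continuous_inclusion hle))
        (f.comp (LevelOrbit.levelCoverCM M Γ₁ π x M' hle)) : Q.G ⧸ Q.Γ → ℂ) =ᵐ[Q.ν]
      (MulAction.orbit M' x).indicator (LevelOrbit.pieceLift M Γ₁ π x f) ∘
        cosetCongr e.symm.toMulEquiv Q.Γ Γ₁ (forall_symm_mem_iff e.toMulEquiv Γ₁ Q.Γ hΓ) := by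
  have h1 := Q.coeFn_transportL2 Γ₁ e hΓ
    (LevelOrbit.pieceLiftLp ℂ M' Γ₁ (π.comp (Subgroup.inclusion hle)) x (Q.pullbackν Γ₁ e hΓ) 2 hM'
      (hπ.comp (continuous_inclusion hle)) (f.comp (LevelOrbit.levelCoverCM M Γ₁ π x M' hle)))
  have h2 := LevelOrbit.coeFn_pieceLiftLp_levelCover ℂ M Γ₁ π M' hle x (Q.pullbackν Γ₁ e hΓ) 2 hπ hM' f
  exact h1.trans
    ((Q.measurePreserving_cosetCongr_symm_pullbackν Γ₁ e hΓ).quasiMeasurePreserving.ae_eq_comp h2)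

/-- **T1 in `Q.H`, package shape** (`Fact_embRestrict`): a.e. on `Q.G ⧸ Q.Γ`,
`pieceEmb_{M'} (f ∘ levelCover) = 𝟙_{𝒫'} · pieceEmb_M f` with `𝒫'` the sub-piece `M' • x` read in `Q.G ⧸ Q.Γ`
through `e`. -/
theorem coeFn_pieceEmb_levelCover_indicator (hM : IsOpen (M : Set G₁)) (hπ : Continuous π)
    (hM' : IsOpen (M' : Set G₁)) (f : C(A ⧸ LevelOrbit.pieceLattice M Γ₁ π x, ℂ)) :
    (Q.pieceEmb Γ₁ e hΓ M' (π.comp (Subgroup.inclusion hle)) x hM' (hπ.comp (continuous_inclusion hle))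
        (f.comp (LevelOrbit.levelCoverCM M Γ₁ π x M' hle)) : Q.G ⧸ Q.Γ → ℂ) =ᵐ[Q.ν]
      (cosetCongr e.symm.toMulEquiv Q.Γ Γ₁ (forall_symm_mem_iff e.toMulEquiv Γ₁ Q.Γ hΓ) ⁻¹'
          MulAction.orbit M' x).indicator
        (Q.pieceEmb Γ₁ e hΓ M π x hM hπ f : Q.G ⧸ Q.Γ → ℂ) := by
  filter_upwards [Q.coeFn_pieceEmb_levelCover Γ₁ e hΓ M π x M' hle hπ hM' f,
    Q.coeFn_pieceEmb Γ₁ e hΓ M π x hM hπ f] with y hyA hyB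
  rw [hyA, Function.comp_apply]
  by_cases hy : cosetCongr e.symm.toMulEquiv Q.Γ Γ₁ (forall_symm_mem_iff e.toMulEquiv Γ₁ Q.Γ hΓ) y ∈
      MulAction.orbit M' x
  · rw [Set.indicator_of_mem hy, Set.indicator_of_mem (Set.mem_preimage.mpr hy), hyB,
      Function.comp_apply]
  · rw [Set.indicator_of_notMem hy, Set.indicator_of_notMem fun h => hy (Set.mem_preimage.mp h)]

/-- **T3 in `Q.H`** (`Fact_embSpread`): for representatives `k_i ∈ M ∩ ker π` normalising `M'` whose sub-pieces
`M' • (k_i • x)` are pairwise disjoint and cover `M • x`, the level-`M` embedding of `f` is the sum of the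
`Q.R (e k_i)`-translates of the level-`M'` embedding of the pull-back `f ∘ levelCover`. -/
theorem pieceEmb_eq_sum_R {ι : Type*} [Fintype ι] (hM : IsOpen (M : Set G₁)) (hπ : Continuous π)
    (hM' : IsOpen (M' : Set G₁)) (k : ι → M) (hk : ∀ i, π (k i) = 1)
    (hkN : ∀ i, (k i : G₁) ∈ Subgroup.normalizer (M' : Set G₁))
    (hdisj : ∀ i j, i ≠ j → Disjoint (MulAction.orbit M' (k i • x)) (MulAction.orbit M' (k j • x)))
    (hcover : MulAction.orbit M x ⊆ ⋃ i, MulAction.orbit M' (k i • x))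
    (f : C(A ⧸ LevelOrbit.pieceLattice M Γ₁ π x, ℂ)) :
    Q.pieceEmb Γ₁ e hΓ M π x hM hπ f =
      ∑ i, Q.R (e (k i))
        (Q.pieceEmb Γ₁ e hΓ M' (π.comp (Subgroup.inclusion hle)) x hM' (hπ.comp (continuous_inclusion hle))
          (f.comp (LevelOrbit.levelCoverCM M Γ₁ π x M' hle))) := by
  rw [pieceEmb_apply, LevelOrbit.pieceLiftLp_eq_sum_translate ℂ M Γ₁ π M' hle x (Q.pullbackν Γ₁ e hΓ) 2 hM
    hπ hM' k hk hkN hdisj hcover f, map_sum]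
  refine Finset.sum_congr rfl fun i _ => ?_
  rw [transportL2_translateLp, pieceEmb_apply]

omit [IsTopologicalGroup A] [CompactSpace (A ⧸ LevelOrbit.pieceLattice M Γ₁ π x)] in
/-- **Distinct translates are orthogonal in `Q.H`.** -/
theorem inner_R_pieceEmb_eq_zero {ι : Type*} (hπ : Continuous π) (hM' : IsOpen (M' : Set G₁)) (k : ι → M)
    (hk : ∀ i, π (k i) = 1) (hkN : ∀ i, (k i : G₁) ∈ Subgroup.normalizer (M' : Set G₁))
    (hdisj : ∀ i j, i ≠ j → Disjoint (MulAction.orbit M' (k i • x)) (MulAction.orbit M' (k j • x)))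
    {i j : ι} (hij : i ≠ j)
    (g' g : C(A ⧸ LevelOrbit.pieceLattice M' Γ₁ (π.comp (Subgroup.inclusion hle)) x, ℂ)) :
    ⟪Q.R (e (k i))
        (Q.pieceEmb Γ₁ e hΓ M' (π.comp (Subgroup.inclusion hle)) x hM' (hπ.comp (continuous_inclusion hle)) g'),
      Q.R (e (k j))
        (Q.pieceEmb Γ₁ e hΓ M' (π.comp (Subgroup.inclusion hle)) x hM' (hπ.comp (continuous_inclusion hle)) g)⟫_ℂ
      = 0 := by
  rw [pieceEmb_apply, pieceEmb_apply, ← transportL2_translateLp, ← transportL2_translateLp, inner_transportL2]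
  exact LevelOrbit.inner_translateLp_pieceLiftLp_eq_zero M Γ₁ π M' hle x _ hM' hπ k hk hkN hdisj hij g' g

/-- **Index law in `Q.H`**: with `r = Fintype.card ι` sub-pieces,
`⟪pieceEmb_M f', pieceEmb_M f⟫ = r · ⟪pieceEmb_{M'} (f' ∘ levelCover), pieceEmb_{M'} (f ∘ levelCover)⟫`. -/
theorem inner_pieceEmb_eq_card_mul {ι : Type*} [Fintype ι] (hM : IsOpen (M : Set G₁)) (hπ : Continuous π)
    (hM' : IsOpen (M' : Set G₁)) (k : ι → M) (hk : ∀ i, π (k i) = 1)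
    (hkN : ∀ i, (k i : G₁) ∈ Subgroup.normalizer (M' : Set G₁))
    (hdisj : ∀ i j, i ≠ j → Disjoint (MulAction.orbit M' (k i • x)) (MulAction.orbit M' (k j • x)))
    (hcover : MulAction.orbit M x ⊆ ⋃ i, MulAction.orbit M' (k i • x))
    (f' f : C(A ⧸ LevelOrbit.pieceLattice M Γ₁ π x, ℂ)) :
    ⟪Q.pieceEmb Γ₁ e hΓ M π x hM hπ f', Q.pieceEmb Γ₁ e hΓ M π x hM hπ f⟫_ℂ =
      (Fintype.card ι : ℂ) *
        ⟪Q.pieceEmb Γ₁ e hΓ M' (π.comp (Subgroup.inclusion hle)) x hM' (hπ.comp (continuous_inclusion hle))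
            (f'.comp (LevelOrbit.levelCoverCM M Γ₁ π x M' hle)),
          Q.pieceEmb Γ₁ e hΓ M' (π.comp (Subgroup.inclusion hle)) x hM' (hπ.comp (continuous_inclusion hle))
            (f.comp (LevelOrbit.levelCoverCM M Γ₁ π x M' hle))⟫_ℂ := by
  simp only [pieceEmb_apply, inner_transportL2]
  exact LevelOrbit.inner_pieceLiftLp_eq_card_mul M Γ₁ π M' hle x _ hM hπ hM' k hk hkN hdisj hcover f' f

/-- **Index law for norms in `Q.H`**: `‖pieceEmb_M f‖² = r · ‖pieceEmb_{M'} (f ∘ levelCover)‖²`. -/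
theorem norm_sq_pieceEmb_eq_card_mul {ι : Type*} [Fintype ι] (hM : IsOpen (M : Set G₁)) (hπ : Continuous π)
    (hM' : IsOpen (M' : Set G₁)) (k : ι → M) (hk : ∀ i, π (k i) = 1)
    (hkN : ∀ i, (k i : G₁) ∈ Subgroup.normalizer (M' : Set G₁))
    (hdisj : ∀ i j, i ≠ j → Disjoint (MulAction.orbit M' (k i • x)) (MulAction.orbit M' (k j • x)))
    (hcover : MulAction.orbit M x ⊆ ⋃ i, MulAction.orbit M' (k i • x))
    (f : C(A ⧸ LevelOrbit.pieceLattice M Γ₁ π x, ℂ)) :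
    ‖Q.pieceEmb Γ₁ e hΓ M π x hM hπ f‖ ^ 2 =
      (Fintype.card ι : ℝ) *
        ‖Q.pieceEmb Γ₁ e hΓ M' (π.comp (Subgroup.inclusion hle)) x hM' (hπ.comp (continuous_inclusion hle))
            (f.comp (LevelOrbit.levelCoverCM M Γ₁ π x M' hle))‖ ^ 2 := by
  simp only [pieceEmb_apply, norm_transportL2]
  exact LevelOrbit.norm_sq_pieceLiftLp_eq_card_mul M Γ₁ π M' hle x _ hM hπ hM' k hk hkN hdisj hcover f

end QuotientModel

end HodgeCM

end
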